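import Mathlib.RingTheory.LocalProperties.Basic
import Mathlib.RingTheory.Localization.Away.Basic
import Mathlib.RingTheory.Localization.Ideal
import Mathlib.RingTheory.Ideal.Quotient.Operations
import Mathlib.RingTheory.Ideal.Maps
import HarnessLib

/-!
# Gluing representing ideals over a basic-open cover
# ([MumfordAV1970] §10, proof of the theorem on p. 89: «the closed subschemes so obtained on the `U_i` patch together»;
# [GortzWedhorn2023] Thm. 24.66, proof pp. 407–408)

Topic `AlgebraicGeometry/Motives` (seesaw-subscheme family), namespace `Literature.AlgebraicGeometry.Motives.SeesawSubscheme`.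
PURE COMMUTATIVE ALGEBRA, Mathlib-only imports; no named fact, no instance, no `sorry`.  Cell `hodgecm-mathlib`, M13
(U-a3 by [MumfordAV1970] §13) node N1 sub-node (mid-b); author A-p14 (g9) on B-p01 (g11)'s specification; books 0.

ABSTRACT SETTING.  `A` a commutative ring (a chart ring `Γ(W, U)`), a predicate `Triv` on `A`-algebras
(«`𝓕_B` is trivialised from the base») subject to
* (M0)  BASE CHANGE: `Triv B → Triv C` along any `A`-algebra tower `A → B → C`;
* (M0′) LOCALITY ON THE TEST RING: for a finite `s ⊆ B` generating the unit ideal,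
        `(∀ g ∈ s, Triv B_g) → Triv B`;
a finite `t ⊆ A` generating the unit ideal, and for each `f ∈ t` a CHART IDEAL `J_f ⊆ A_f` representing `Triv`
on `A_f`-algebras: `Triv B ↔ J_f·B = 0` for every `A_f`-algebra `B` (compatible `A`-structure).
RESULTS.  `triv_iff_map_gluedIdeal_eq_bot` / `exists_ideal_forall_triv_iff`: ONE ideal `J ⊆ A` (namely
`gluedIdeal t J := ⨅_{f ∈ t} (A → A_f)⁻¹ J_f`) with `Triv B ↔ J·B = 0` for EVERY `A`-algebra `B` — `V(J)` represents
`Triv` on the whole chart; `map_gluedIdeal_eq : J·A_f = J_f` (clearing denominators over the finite cover);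
`exists_pow_mul_mem_of_mem`: the overlap compatibility `J_f·A_{ff′} = J_{f′}·A_{ff′}` is FREE from the hypothesis
(test ring `A_{f′,f} ⧸ J_{f′}·A_{f′,f}`); `Ideal.eq_bot_of_forall_away_finset`: an ideal killed in every `B_g` of a
finite basic-open cover is `0`; the EMPTY-CHART lemma `triv_iff_map_top_eq_bot`; and the SOCKET FORM
`idealGluing_socket` (chart hypothesis with the composite `A`-structure `A → A_f → B` as a `letI`, interchangeable with
the scalar-tower form by `Algebra.algebra_ext`).  HC_CM is proved only modulo the 7 printed citations until rung 0 closes.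

## References
* [MumfordAV1970] D. Mumford, *Abelian Varieties* (1970), §10 (seesaw theorem in scheme form, p. 89).
* [GortzWedhorn2023] U. Görtz, T. Wedhorn, *Algebraic Geometry II* (2023), Thm. 24.66 and its proof (pp. 405–408).
* [AtiyahMacdonald1969] M. Atiyah, I. Macdonald, *Introduction to Commutative Algebra* (1969), Chap. 3
  (rings of fractions: universal property Prop. 3.1 p. 37, extended ideals Prop. 3.11 p. 41, local properties Prop. 3.8 p. 40).
-/

set_option autoImplicit false

universe u

namespace Literature.AlgebraicGeometry.Motives.SeesawSubscheme

open IsLocalization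

variable {A : Type u} [CommRing A]

/-! ## §1 Generic localisation lemmas -/

/-- **An element killed in every `B_g` of a finite basic-open cover of `Spec B` is zero.**
[cite: GortzWedhorn2023, Thm. 24.66, proof (pp. 407–408)] -/
theorem eq_zero_of_forall_away_finset {B : Type u} [CommRing B] (s : Finset B)
    (hs : Ideal.span (s : Set B) = ⊤) (y : B)
    (h : ∀ g ∈ s, algebraMap B (Localization.Away g) y = 0) : y = 0 := by
  -- the annihilator of `y` contains a power of every `g ∈ s`, hence is `⊤`
  let K : Ideal B := (Submodule.span B {y}).annihilator
  suffices hK : K = ⊤ by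
    have h1 : (1 : B) ∈ K := hK ▸ Submodule.mem_top
    simpa using (Submodule.mem_annihilator_span_singleton y 1).mp h1
  by_contra hK
  obtain ⟨𝔪, h𝔪, hK𝔪⟩ := Ideal.exists_le_maximal K hK
  -- some `g ∈ s` lies outside `𝔪`
  have hex : ∃ g ∈ s, g ∉ 𝔪 := by
    by_contra hall
    push Not at hall
    have hle : Ideal.span (s : Set B) ≤ 𝔪 := Ideal.span_le.mpr fun g hg => hall g hg
    exact h𝔪.ne_top (top_le_iff.mp (hs ▸ hle))
  obtain ⟨g, hg, hg𝔪⟩ := hex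
  obtain ⟨⟨m, hm⟩, hmy⟩ := (IsLocalization.map_eq_zero_iff (Submonoid.powers g) _ _).mp (h g hg)
  obtain ⟨n, rfl⟩ := hm
  have hgn : g ^ n ∈ K := (Submodule.mem_annihilator_span_singleton _ _).mpr (by simpa using hmy)
  exact hg𝔪 (h𝔪.isPrime.mem_of_pow_mem n (hK𝔪 hgn))

/-- **An ideal killed in every `B_g` of a finite basic-open cover of `Spec B` is zero.**
[cite: GortzWedhorn2023, Thm. 24.66, proof (pp. 407–408)] -/
theorem Ideal.eq_bot_of_forall_away_finset {B : Type u} [CommRing B] (s : Finset B)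
    (hs : Ideal.span (s : Set B) = ⊤) (K : Ideal B)
    (h : ∀ g ∈ s, K.map (algebraMap B (Localization.Away g)) = ⊥) : K = ⊥ := by
  refine eq_bot_iff.mpr fun y hy => ?_
  rw [Submodule.mem_bot]
  refine eq_zero_of_forall_away_finset s hs y fun g hg => ?_
  have := Ideal.mem_map_of_mem (algebraMap B (Localization.Away g)) hy
  rwa [h g hg, Submodule.mem_bot] at this

/-- The image of a generating finite set generates the unit ideal. [cite: GortzWedhorn2023, Thm. 24.66, proof (pp. 407–408)] -/
theorem span_image_algebraMap_eq_top {B : Type u} [CommRing B] [Algebra A B] [DecidableEq B]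
    (t : Finset A) (ht : Ideal.span (t : Set A) = ⊤) :
    Ideal.span ((t.image (algebraMap A B) : Finset B) : Set B) = ⊤ := by
  have h := congrArg (Ideal.map (algebraMap A B)) ht
  rw [Ideal.map_span, Ideal.map_top] at h
  simpa [Finset.coe_image] using h

/-! ## §2 The `A_f`-algebra structure on an `A`-algebra in which `f` is invertible -/

/-- The structure map `A_f → B` of an `A`-algebra `B` in which `f` is a unit (localisation lift).
[cite: AtiyahMacdonald1969, Chap. 3 Prop. 3.1 p. 37] -/
@[reducible] noncomputable def awayAlgebraOfIsUnit (f : A) (B : Type u) [CommRing B] [Algebra A B]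
    (hf : IsUnit (algebraMap A B f)) : Algebra (Localization.Away f) B :=
  (IsLocalization.Away.lift f (g := algebraMap A B) hf).toAlgebra

/-- The lifted structure is compatible with the `A`-structures. [cite: AtiyahMacdonald1969, Chap. 3 Prop. 3.1 p. 37] -/
theorem isScalarTower_awayAlgebraOfIsUnit (f : A) (B : Type u) [CommRing B] [Algebra A B]
    (hf : IsUnit (algebraMap A B f)) :
    letI := awayAlgebraOfIsUnit f B hf
    IsScalarTower A (Localization.Away f) B := by
  letI := awayAlgebraOfIsUnit f B hf
  refine IsScalarTower.of_algebraMap_eq fun a => ?_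
  exact (IsLocalization.Away.lift_eq f hf a).symm

/-! ## §3 The glued ideal and the chart identity `J·A_f = J_f` -/

section Glue

variable (t : Finset A) (J : ∀ f : A, Ideal (Localization.Away f))

/-- The GLUED ideal `⨅_{f ∈ t} (A → A_f)⁻¹ J_f`. [cite: MumfordAV1970, §10 (p. 89)] -/
def gluedIdeal : Ideal A := ⨅ f ∈ t, (J f).comap (algebraMap A (Localization.Away f))

/-- The glued ideal lies in each chart preimage. [cite: MumfordAV1970, §10 (p. 89)] -/
theorem gluedIdeal_le_comap {f : A} (hf : f ∈ t) :
    gluedIdeal t J ≤ (J f).comap (algebraMap A (Localization.Away f)) :=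
  (iInf_le _ f).trans (iInf_le _ hf)

/-- Membership in the glued ideal, chart by chart. [cite: MumfordAV1970, §10 (p. 89)] -/
theorem mem_gluedIdeal_iff {a : A} :
    a ∈ gluedIdeal t J ↔ ∀ f ∈ t, algebraMap A (Localization.Away f) a ∈ J f := by
  simp only [gluedIdeal, Ideal.mem_iInf, Ideal.mem_comap]

/-- `J·A_f ≤ J_f`. [cite: MumfordAV1970, §10 (p. 89)] -/
theorem map_gluedIdeal_le {f : A} (hf : f ∈ t) :
    (gluedIdeal t J).map (algebraMap A (Localization.Away f)) ≤ J f :=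
  Ideal.map_le_iff_le_comap.mpr (gluedIdeal_le_comap t J hf)

end Glue

/-- The OVERLAP TEST RING `A_{f′,f} := (A_{f′})_f`. [cite: AtiyahMacdonald1969, Chap. 3 p. 36] -/
abbrev OverlapRing (f f' : A) : Type u := Localization.Away (algebraMap A (Localization.Away f') f)

/-- The ideal `J_{f′}·A_{f′,f}` of the overlap test ring. [cite: AtiyahMacdonald1969, Chap. 3 Prop. 3.11 p. 41] -/
abbrev overlapIdeal (f f' : A) (Jf' : Ideal (Localization.Away f')) : Ideal (OverlapRing f f') :=
  Jf'.map (algebraMap (Localization.Away f') (OverlapRing f f'))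

/-- The OVERLAP TEST QUOTIENT `A_{f′,f} ⧸ J_{f′}·A_{f′,f}`. [cite: AtiyahMacdonald1969, Chap. 3 Prop. 3.11 p. 41] -/
abbrev OverlapQuot (f f' : A) (Jf' : Ideal (Localization.Away f')) : Type u :=
  OverlapRing f f' ⧸ overlapIdeal f f' Jf'

/-- **Overlap compatibility, free from representability.**  If `J_f` represents `Triv` on `A_f`-algebras and
`J_{f′}` on `A_{f′}`-algebras, then every `a ∈ A` with `a/1 ∈ J_f` has `f^k·a/1 ∈ J_{f′}` for some `k`
(test ring: `A_{f′,f} ⧸ J_{f′}·A_{f′,f}`). [cite: MumfordAV1970, §10 (p. 89)] -/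
theorem exists_pow_mul_mem_of_mem
    (Triv : ∀ (B : Type u) [CommRing B] [Algebra A B], Prop)
    {f f' : A} (Jf : Ideal (Localization.Away f)) (Jf' : Ideal (Localization.Away f'))
    (hJf : ∀ (B : Type u) [CommRing B] [Algebra A B] [Algebra (Localization.Away f) B]
      [IsScalarTower A (Localization.Away f) B], Triv B ↔ Jf.map (algebraMap (Localization.Away f) B) = ⊥)
    (hJf' : ∀ (B : Type u) [CommRing B] [Algebra A B] [Algebra (Localization.Away f') B]
      [IsScalarTower A (Localization.Away f') B], Triv B ↔ Jf'.map (algebraMap (Localization.Away f') B) = ⊥)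
    {a : A} (ha : algebraMap A (Localization.Away f) a ∈ Jf) :
    ∃ k : ℕ, algebraMap A (Localization.Away f') (f ^ k * a) ∈ Jf' := by
  -- `J_{f'}` dies in the overlap quotient `D := A_{f',f} ⧸ J_{f'}·A_{f',f}`, so `D` is trivialised
  have hD' : Jf'.map (algebraMap (Localization.Away f') (OverlapQuot f f' Jf') :
      Localization.Away f' →+* OverlapQuot f f' Jf') = ⊥ := by
    rw [IsScalarTower.algebraMap_eq (Localization.Away f') (OverlapRing f f') (OverlapQuot f f' Jf'),
      ← Ideal.map_map, Ideal.Quotient.algebraMap_eq, Ideal.map_quotient_self]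
  have hTD : Triv (OverlapQuot f f' Jf') := (hJf' _).mpr hD'
  -- `f` is a unit in `D`, so `D` is an `A_f`-algebra and `J_f` dies in it
  have hfC : IsUnit (algebraMap A (OverlapRing f f') f) := by
    rw [IsScalarTower.algebraMap_apply A (Localization.Away f') (OverlapRing f f')]
    exact IsLocalization.Away.algebraMap_isUnit (algebraMap A (Localization.Away f') f)
  have hfD : IsUnit ((algebraMap A (OverlapQuot f f' Jf') : A →+* OverlapQuot f f' Jf') f) := by
    rw [IsScalarTower.algebraMap_apply A (OverlapRing f f') (OverlapQuot f f' Jf')]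
    exact hfC.map _
  letI : Algebra (Localization.Away f) (OverlapQuot f f' Jf') :=
    awayAlgebraOfIsUnit f (OverlapQuot f f' Jf') hfD
  haveI : IsScalarTower A (Localization.Away f) (OverlapQuot f f' Jf') :=
    isScalarTower_awayAlgebraOfIsUnit f (OverlapQuot f f' Jf') hfD
  have hJD : Jf.map (algebraMap (Localization.Away f) (OverlapQuot f f' Jf') :
      Localization.Away f →+* OverlapQuot f f' Jf') = ⊥ := (hJf _).mp hTD
  -- hence `a ↦ 0` in `D`, i.e. `a/1 ∈ J_{f'}·A_{f',f}`
  have ha0 : (algebraMap A (OverlapQuot f f' Jf') : A →+* OverlapQuot f f' Jf') a = 0 := by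
    have h := Ideal.mem_map_of_mem
      (algebraMap (Localization.Away f) (OverlapQuot f f' Jf') : Localization.Away f →+* OverlapQuot f f' Jf') ha
    rw [hJD, ← IsScalarTower.algebraMap_apply, Submodule.mem_bot] at h
    exact h
  have haC : algebraMap (Localization.Away f') (OverlapRing f f') (algebraMap A (Localization.Away f') a) ∈
      overlapIdeal f f' Jf' := by
    rw [← IsScalarTower.algebraMap_apply, ← Ideal.Quotient.eq_zero_iff_mem,
      ← Ideal.Quotient.algebraMap_eq, ← IsScalarTower.algebraMap_apply]
    exact ha0
  -- clear the denominator: `f^k · a/1 ∈ J_{f'}`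
  obtain ⟨m, hm, hma⟩ :=
    (IsLocalization.algebraMap_mem_map_algebraMap_iff
      (Submonoid.powers (algebraMap A (Localization.Away f') f)) (OverlapRing f f') Jf'
      (algebraMap A (Localization.Away f') a)).mp haC
  obtain ⟨k, rfl⟩ := hm
  exact ⟨k, by simpa [map_mul, map_pow] using hma⟩

section Main

variable (Triv : ∀ (B : Type u) [CommRing B] [Algebra A B], Prop)
  (t : Finset A) (J : ∀ f : A, Ideal (Localization.Away f))
  (hJ : ∀ f ∈ t, ∀ (B : Type u) [CommRing B] [Algebra A B] [Algebra (Localization.Away f) B]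
    [IsScalarTower A (Localization.Away f) B], Triv B ↔ (J f).map (algebraMap (Localization.Away f) B) = ⊥)

/-- **(mid-c) THE EMPTY CHART**: if no non-zero `A_f`-algebra is trivialised (and the zero ring is), then the unit
ideal `⊤ ⊆ A_f` represents `Triv` on `A_f`-algebras. [cite: MumfordAV1970, §10 (p. 89)] -/
theorem triv_iff_map_top_eq_bot (f : A)
    (h : ∀ (B : Type u) [CommRing B] [Algebra A B] [Algebra (Localization.Away f) B]
      [IsScalarTower A (Localization.Away f) B], Triv B → Subsingleton B)
    (h0 : ∀ (B : Type u) [CommRing B] [Algebra A B], Subsingleton B → Triv B)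
    (B : Type u) [CommRing B] [Algebra A B] [Algebra (Localization.Away f) B]
    [IsScalarTower A (Localization.Away f) B] :
    Triv B ↔ (⊤ : Ideal (Localization.Away f)).map (algebraMap (Localization.Away f) B) = ⊥ := by
  rw [Ideal.map_top]
  constructor
  · intro hB
    haveI := h B hB
    exact (Submodule.eq_bot_iff _).mpr fun x _ => Subsingleton.elim x 0
  · intro htop
    have h10 : (1 : B) = 0 := by
      have h1 : (1 : B) ∈ (⊥ : Ideal B) := htop ▸ Submodule.mem_top
      exact (Submodule.mem_bot B).mp h1
    exact h0 B (subsingleton_of_zero_eq_one h10.symm)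

include hJ

/-- **Chart identity `J·A_f = J_f`** for the glued ideal (clearing denominators over the finite cover).
[cite: MumfordAV1970, §10 (p. 89)] [cite: GortzWedhorn2023, Thm. 24.66, proof (pp. 407–408)] -/
theorem map_gluedIdeal_eq {f : A} (hf : f ∈ t) :
    (gluedIdeal t J).map (algebraMap A (Localization.Away f)) = J f := by
  classical
  refine le_antisymm (map_gluedIdeal_le t J hf) fun x hx => ?_
  -- write `x = a / f^n`
  obtain ⟨⟨a, ⟨_, n, rfl⟩⟩, hxa⟩ := IsLocalization.surj (Submonoid.powers f) x
  have ha : algebraMap A (Localization.Away f) a ∈ J f := by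
    change x * algebraMap A _ (f ^ n) = algebraMap A _ a at hxa
    rw [← hxa]
    exact Ideal.mul_mem_right _ _ hx
  -- for every `f' ∈ t`, some power of `f` times `a` lies in `J_{f'}`; take the maximum
  have hk : ∀ f' ∈ t, ∃ k : ℕ, algebraMap A (Localization.Away f') (f ^ k * a) ∈ J f' :=
    fun f' hf' => exists_pow_mul_mem_of_mem Triv (J f) (J f') (hJ f hf) (hJ f' hf') ha
  choose! k hk using hk
  let N := t.sup k
  have hN : f ^ N * a ∈ gluedIdeal t J := by
    rw [mem_gluedIdeal_iff]
    intro f' hf'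
    have hle : k f' ≤ N := Finset.le_sup hf'
    have : f ^ N * a = f ^ (N - k f') * (f ^ k f' * a) := by
      rw [← mul_assoc, ← pow_add, Nat.sub_add_cancel hle]
    rw [this, map_mul]
    exact Ideal.mul_mem_left _ _ (hk f' hf')
  -- `x = (f^N a)/1 · (1/f^(N+n))`
  have hunit : IsUnit (algebraMap A (Localization.Away f) (f ^ (N + n))) := by
    rw [map_pow]; exact (IsLocalization.Away.algebraMap_isUnit f).pow _
  have hx' : x * algebraMap A _ (f ^ (N + n)) = algebraMap A _ (f ^ N * a) := by
    change x * algebraMap A _ (f ^ n) = algebraMap A _ a at hxa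
    rw [pow_add, map_mul, map_mul, ← hxa]; ring
  rw [← Ideal.unit_mul_mem_iff_mem _ hunit, mul_comm, hx']
  exact Ideal.mem_map_of_mem _ hN

/-- **The glued ideal represents `Triv` on ALL `A`-algebras**: `Triv B ↔ (⨅_f (A → A_f)⁻¹ J_f)·B = 0`, given base
change (M0), basic-open locality (M0′) and the chart representabilities. [cite: MumfordAV1970, §10 (p. 89)]
[cite: GortzWedhorn2023, Thm. 24.66, proof (pp. 407–408)] -/
theorem triv_iff_map_gluedIdeal_eq_bot
    (hbc : ∀ (B : Type u) [CommRing B] [Algebra A B] (C : Type u) [CommRing C] [Algebra A C]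
      [Algebra B C] [IsScalarTower A B C], Triv B → Triv C)
    (hloc : ∀ (B : Type u) [CommRing B] [Algebra A B] (s : Finset B), Ideal.span (s : Set B) = ⊤ →
      (∀ g ∈ s, Triv (Localization.Away g)) → Triv B)
    (ht : Ideal.span (t : Set A) = ⊤) (B : Type u) [CommRing B] [Algebra A B] :
    Triv B ↔ (gluedIdeal t J).map (algebraMap A B) = ⊥ := by
  classical
  -- on the chart `f ∈ t`: the `A_f`-algebra `B_f := Localization.Away (algebraMap A B f)`
  have key : ∀ f ∈ t,
      (((gluedIdeal t J).map (algebraMap A B)).map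
          (algebraMap B (Localization.Away (algebraMap A B f))) = ⊥ ↔
        Triv (Localization.Away (algebraMap A B f))) := by
    intro f hf
    have hfu : IsUnit (algebraMap A (Localization.Away (algebraMap A B f)) f) := by
      rw [IsScalarTower.algebraMap_apply A B (Localization.Away (algebraMap A B f))]
      exact IsLocalization.Away.algebraMap_isUnit (algebraMap A B f)
    letI : Algebra (Localization.Away f) (Localization.Away (algebraMap A B f)) :=
      awayAlgebraOfIsUnit f (Localization.Away (algebraMap A B f)) hfu
    haveI : IsScalarTower A (Localization.Away f) (Localization.Away (algebraMap A B f)) :=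
      isScalarTower_awayAlgebraOfIsUnit f (Localization.Away (algebraMap A B f)) hfu
    rw [hJ f hf (Localization.Away (algebraMap A B f)), ← map_gluedIdeal_eq Triv t J hJ hf, Ideal.map_map,
      Ideal.map_map, ← IsScalarTower.algebraMap_eq, ← IsScalarTower.algebraMap_eq]
  constructor
  · -- (⇒): `J·B` dies in every `B_f`, `f ∈ t`, by (M0) and the chart representability; hence `J·B = 0`
    intro hB
    refine Ideal.eq_bot_of_forall_away_finset (t.image (algebraMap A B))
      (span_image_algebraMap_eq_top t ht) _ fun g hg => ?_
    obtain ⟨f, hf, rfl⟩ := Finset.mem_image.mp hg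
    exact (key f hf).mpr (hbc B (Localization.Away (algebraMap A B f)) hB)
  · -- (⇐): every `B_f` is trivialised by the chart representability; conclude by (M0′)
    intro hI
    refine hloc B (t.image (algebraMap A B)) (span_image_algebraMap_eq_top t ht) fun g hg => ?_
    obtain ⟨f, hf, rfl⟩ := Finset.mem_image.mp hg
    exact (key f hf).mp (by rw [hI, Ideal.map_bot])

/-- **(mid-b) GLUING REPRESENTING IDEALS OVER A BASIC-OPEN COVER** ([MumfordAV1970] §10 p. 89; [GortzWedhorn2023]
Thm. 24.66): if `Triv` satisfies base change (M0) and basic-open locality on the test ring (M0′), and on each chart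
`A_f` (`f ∈ t`, `(t) = A`) an ideal `J_f ⊆ A_f` represents `Triv` on `A_f`-algebras, then ONE ideal `J ⊆ A`
(namely `⨅_f (A → A_f)⁻¹ J_f`) represents `Triv` on ALL `A`-algebras: `Triv B ↔ J·B = 0`.
[cite: MumfordAV1970, §10 (p. 89)] [cite: GortzWedhorn2023, Thm. 24.66, proof (pp. 407–408)] -/
theorem exists_ideal_forall_triv_iff
    (hbc : ∀ (B : Type u) [CommRing B] [Algebra A B] (C : Type u) [CommRing C] [Algebra A C]
      [Algebra B C] [IsScalarTower A B C], Triv B → Triv C)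
    (hloc : ∀ (B : Type u) [CommRing B] [Algebra A B] (s : Finset B), Ideal.span (s : Set B) = ⊤ →
      (∀ g ∈ s, Triv (Localization.Away g)) → Triv B)
    (ht : Ideal.span (t : Set A) = ⊤) :
    ∃ I : Ideal A, ∀ (B : Type u) [CommRing B] [Algebra A B], Triv B ↔ I.map (algebraMap A B) = ⊥ :=
  ⟨gluedIdeal t J, fun B _ _ => triv_iff_map_gluedIdeal_eq_bot Triv t J hJ hbc hloc ht B⟩

end Main

/-! ## §5 Socket form (the consumer's `idealGluing` shape, binder-for-binder)

In the consumer's socket the chart hypothesis quantifies over `A_f`-algebras `B` and EQUIPS them with the composite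
`A`-structure `A → A_f → B` (a `letI`), instead of asking for a compatible pair of structures; the two forms are
interchangeable by `Algebra.algebra_ext`. -/

section SocketForm

/-- From the socket's chart hypothesis (composite `A`-structure) to the scalar-tower form used above.
[cite: AtiyahMacdonald1969, Chap. 3 Prop. 3.1 p. 37] -/
theorem chart_iff_of_socket_form (Triv : ∀ (B : Type u) [CommRing B] [Algebra A B], Prop) (f : A)
    (Jf : Ideal (Localization.Away f))
    (h : ∀ (B : Type u) [CommRing B] [Algebra (Localization.Away f) B],
      (letI : Algebra A B := ((algebraMap (Localization.Away f) B).comp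
        (algebraMap A (Localization.Away f))).toAlgebra; Triv B) ↔
        Jf.map (algebraMap (Localization.Away f) B) = ⊥)
    (B : Type u) [CommRing B] [inst : Algebra A B] [Algebra (Localization.Away f) B]
    [IsScalarTower A (Localization.Away f) B] :
    Triv B ↔ Jf.map (algebraMap (Localization.Away f) B) = ⊥ := by
  have hinst : ((algebraMap (Localization.Away f) B).comp (algebraMap A (Localization.Away f))).toAlgebra =
      inst :=
    Algebra.algebra_ext _ _ fun r => (IsScalarTower.algebraMap_apply A (Localization.Away f) B r).symm
  have h' := h B
  rw [hinst] at h'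
  exact h'

/-- **Gluing representing ideals, SOCKET FORM** — the chart hypothesis equips each `A_f`-algebra with the composite
`A`-structure (universe-polymorphic in `A`/`B`; the seesaw consumer instantiates at `Type`). [cite: MumfordAV1970, §10 (p. 89)]
[cite: GortzWedhorn2023, Thm. 24.66, proof (pp. 407–408)] -/
theorem idealGluing_socket :
    ∀ (A : Type u) [CommRing A] (T : ∀ (B : Type u) [CommRing B] [Algebra A B], Prop),
    (∀ (B C : Type u) [CommRing B] [Algebra A B] [CommRing C] [Algebra A C] [Algebra B C]
      [IsScalarTower A B C], T B → T C) →
    (∀ (B : Type u) [CommRing B] [Algebra A B] (s : Finset B), Ideal.span (s : Set B) = ⊤ →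
      (∀ g ∈ s, T (Localization.Away g)) → T B) →
    ∀ (t : Finset A), Ideal.span (t : Set A) = ⊤ →
    ∀ (J : ∀ f : A, Ideal (Localization.Away f)),
      (∀ f ∈ t, ∀ (B : Type u) [CommRing B] [Algebra (Localization.Away f) B],
        (letI : Algebra A B := ((algebraMap (Localization.Away f) B).comp
          (algebraMap A (Localization.Away f))).toAlgebra; T B) ↔
          (J f).map (algebraMap (Localization.Away f) B) = ⊥) →
      ∃ Jg : Ideal A, ∀ (B : Type u) [CommRing B] [Algebra A B], T B ↔ Jg.map (algebraMap A B) = ⊥ := by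
  intro A _ T hbc hloc t ht J hJ
  exact exists_ideal_forall_triv_iff T t J
    (fun f hf B _ _ _ _ => chart_iff_of_socket_form T f (J f) (hJ f hf) B)
    (fun B _ _ C _ _ _ _ hB => hbc B C hB) hloc ht

end SocketForm

end Literature.AlgebraicGeometry.Motives.SeesawSubscheme
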